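import Literature.AlgebraicGeometry.Frobenioids.ElementaryIsFrobenioid
import Literature.AlgebraicGeometry.Frobenioids.FSMIMorphisms
import HarnessLib

/-!
# Frobenioids I, Proposition 1.14 (iii): the printed converse fails for the standard Frobenioid

Mochizuki, *The geometry of Frobenioids I: the general theory*, Kyushu J. Math. **62** (2008)
293–400, §1, Proposition 1.14 (iii), kurims text pp. 41–43 [cite: MochizukiFrdI2008, Prop. 1.14].

> "(iii) Suppose that `φ` is irreducible. Then `φ` is a non-pre-step if and only if the
> following condition holds: There exists an `N ∈ N_{≥1}` such that for every equality of
> composites in `C` `αₙ ∘ αₙ₋₁ ∘ … ∘ α₂ ∘ α₁ = ψ ∘ φ` — where `α₁, …, αₙ, ψ` are FSMI-morphisms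
> [cf. §0] — it holds that `n ≤ N`."

The implication "⟹" is proved in `IrreducibleMorphismsChains.lean`. This file types the printed
biconditional as the named statement `NonPreStepIffBoundedFSMIChains` (NOT asserted) and records,
kernel-checked, that it FAILS for the *standard Frobenioid* of Def. 1.1 (iii): `Φ = Φ_{ℤ_{≥0}}`, the
constant monoid `(ℤ_{≥0}, +)` (here `Multiplicative ℕ`, a pre-divisorial monoid) on the
one-morphism category (connected, totally epimorphic, of FSM- hence FSMFF-type), `C = F_Φ` (a
Frobenioid of isotropic type by Prop. 1.5, found's `ElemFrobenioid.isFrobenioid_toChar`), and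
`φ = (id, 1, 1)`, an irreducible pre-step:

* a morphism `(id, z, k)` with `k ≥ 2` is not fiberwise-surjective (against `γ = (id, z + 1, k)` one
  would need `k · x = 1 + k · y`), so every FSMI-morphism of `C` has Frobenius degree `1` and (being
  irreducible) zero divisor `1` — the printed argument (p. 42, "taking `ψ` to be a prime-Frobenius
  morphism of increasingly large Frobenius degree") presumes that prime-Frobenius morphisms are
  FSMI-morphisms;
* hence a composite of `n` FSMI-morphisms has zero divisor `n`, while `ψ ∘ φ` has zero divisor `2`:
  the printed condition holds for the pre-step `φ` with `N = 2` (`not_NonPreStepIffBoundedFSMIChains`).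

This file asserts nothing beyond the kernel-checked example; which repaired statement the author
intends (e.g. with "irreducible" in place of "FSMI") is for the referee/planner to decide. Downstream
use in the paper: proof of [FrdI] Thm. 3.4 (ii), p. 63 ("Ψ preserves pre-steps follows formally from
Proposition 1.14, (ii), (iii)").
-/

namespace Literature.AlgebraicGeometry.Frobenioids

open CategoryTheory Opposite

universe w v v' u u'

namespace PreFrobenioid

/-- FALSE AS TYPED (erratum candidate / printed-claim-under-review): **Prop. 1.14 (iii) as printed**
(FrdI p. 41), for a Frobenioid `C → F_Φ` of isotropic type over a base category `D` of FSMFF-type: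
"Suppose that `φ` is irreducible. Then `φ` is a non-pre-step if and only if … there exists an
`N ∈ N_{≥1}` such that for every equality of composites `αₙ ∘ … ∘ α₁ = ψ ∘ φ` — where
`α₁, …, αₙ, ψ` are FSMI-morphisms — it holds that `n ≤ N`." Refuted below by the standard
Frobenioid (`StandardFrobenioidExample.not_NonPreStepIffBoundedFSMIChains`; cell flag 9 /
proof-route finding PR-1, since the printed proof of [FrdI] Thm. 3.4 (ii) cites this "⟸").
Its "⟹" half holds as printed: `PreFrobenioid.exists_chain_bound_of_not_isPreStep`
(`IrreducibleMorphismsChains.lean`). Repaired reading: `NonPreStepIffBoundedFSMIChainsOfFSMI`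
below (extra hypothesis: prime-Frobenius morphisms are FSMI-morphisms — exactly what the printed
argument "taking `ψ` to be a prime-Frobenius morphism of increasingly large Frobenius degree",
p. 42, uses). Consumers must NOT bind `(h : NonPreStepIffBoundedFSMIChains)`.
[cite: MochizukiFrdI2008, Prop. 1.14(iii) p.41] -/
def NonPreStepIffBoundedFSMIChains : Prop :=
  ∀ {D : Type u} [Category.{v} D] {Φ : Dᵒᵖ ⥤ CommMonCat.{w}} {C : Type u'} [Category.{v'} C]
    (F : C ⥤ ElemFrobenioid Φ), IsFrobenioid F → IsOfIsotropicType F → IsOfFSMFFType D →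
    ∀ {A B : C} (φ : A ⟶ B), IsIrreducibleHom φ →
      (¬ IsPreStep F φ ↔
        ∃ N : ℕ, ∀ ⦃B' : C⦄ (ψ : B ⟶ B') (n : ℕ), IsFSMI ψ → IsFSMIChain (φ ≫ ψ) n → n ≤ N)

/-- REPAIRED READING (R1) of Prop. 1.14 (iii) — ours, not printed: the printed biconditional under
the extra hypothesis that every prime-Frobenius morphism of `C` is an FSMI-morphism (for a
Frobenioid of isotropic type: is fiberwise-surjective and a monomorphism; irreducibility is
Prop. 1.10 (iv)). Under this hypothesis the printed necessity argument (p. 42: for an irreducible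
pre-step `φ` and a prime-Frobenius `ψ` of degree `p`, `ψ ∘ φ` is a composite of `p + 1`
FSMI-morphisms, Prop. 1.10 (ii) and Def. 1.3 (iii)(d)) goes through; the "⟹" half needs no extra
hypothesis (`exists_chain_bound_of_not_isPreStep`). The standard Frobenioid violates the
hypothesis (its prime-Frobenius morphisms are not fiberwise-surjective,
`StandardFrobenioidExample.degFr_eq_one_of_isFiberwiseSurjective`) and the conclusion. Typed as a
statement; its proof is filed separately (`IrreducibleMorphismsChainsConverse.lean`).
[cite: MochizukiFrdI2008, Prop. 1.14(iii) p.41] -/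
def NonPreStepIffBoundedFSMIChainsOfFSMI : Prop :=
  ∀ {D : Type u} [Category.{v} D] {Φ : Dᵒᵖ ⥤ CommMonCat.{w}} {C : Type u'} [Category.{v'} C]
    (F : C ⥤ ElemFrobenioid Φ), IsFrobenioid F → IsOfIsotropicType F → IsOfFSMFFType D →
    (∀ {X Y : C} (ψ : X ⟶ Y), IsPrimeFrobenius F ψ → IsFSMI ψ) →
    ∀ {A B : C} (φ : A ⟶ B), IsIrreducibleHom φ →
      (¬ IsPreStep F φ ↔
        ∃ N : ℕ, ∀ ⦃B' : C⦄ (ψ : B ⟶ B') (n : ℕ), IsFSMI ψ → IsFSMIChain (φ ≫ ψ) n → n ≤ N)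

end PreFrobenioid

namespace StandardFrobenioidExample

/-! ### The monoid `(ℤ_{≥0}, +)`, written multiplicatively -/

/-- The divisor monoid of the standard Frobenioid: `(ℤ_{≥0}, +)` written multiplicatively
(FrdI Def. 1.1 (iii)). [cite: MochizukiFrdI2008, Def. 1.1(iii) p.20] -/
abbrev M : Type := Multiplicative ℕ

/-- Units of `(ℤ_{≥0}, +)` are trivial. [cite: MochizukiFrdI2008, §0 p.11] -/
theorem eq_one_of_isUnit_M (x : M) (hx : IsUnit x) : x = 1 := by
  obtain ⟨u, rfl⟩ := hx
  have h : u.1.toAdd + u.2.toAdd = 0 := by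
    have := congrArg Multiplicative.toAdd u.3
    rwa [toAdd_mul, toAdd_one] at this
  exact congrArg Multiplicative.ofAdd (Nat.eq_zero_of_add_eq_zero_right h)

/-- `(ℤ_{≥0}, +)` is sharp. [cite: MochizukiFrdI2008, §0 p.11] -/
theorem isSharp_M : IsSharp M := ⟨eq_one_of_isUnit_M⟩

/-- In `(ℤ_{≥0}, +)` associated elements are equal. [cite: MochizukiFrdI2008, §0 p.11] -/
theorem eq_of_associated_M {x y : M} (h : Associated x y) : x = y := by
  obtain ⟨u, hu⟩ := h
  rw [eq_one_of_isUnit_M _ u.isUnit, mul_one] at hu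
  exact hu

/-- `(ℤ_{≥0}, +)` is of characteristic type (no units). [cite: MochizukiFrdI2008, §0 p.11] -/
theorem isOfCharType_M : IsOfCharType M :=
  ⟨fun u _ _ => Units.ext (eq_one_of_isUnit_M _ u.isUnit)⟩

/-- `(ℤ_{≥0}, +)` is integral (cancellative). [cite: MochizukiFrdI2008, §0 p.11] -/
theorem isIntegral_M : IsIntegral M := isIntegral_iff_isCancelMul.mpr inferInstance

/-- Two elements of `N^gp` with the same image agree up to a common factor (localisation).
[cite: MochizukiFrdI2008, §0 p.11] -/
private theorem gp_of_eq_of_iff {N : Type} [CommMonoid N] {a b : N} :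
    Algebra.GrothendieckGroup.of a = Algebra.GrothendieckGroup.of b ↔ ∃ c : N, c * a = c * b :=
  ((Localization.monoidOf (⊤ : Submonoid N)).eq_iff_exists).trans
    ⟨fun ⟨c, h⟩ => ⟨c, h⟩, fun ⟨c, h⟩ => ⟨⟨c, Submonoid.mem_top c⟩, h⟩⟩

/-- Every element of `N^gp` is a fraction. [cite: MochizukiFrdI2008, §0 p.11] -/
private theorem gp_exists_eq_div {N : Type} [CommMonoid N] (x : Algebra.GrothendieckGroup N) :
    ∃ a b : N, x = Algebra.GrothendieckGroup.of a / Algebra.GrothendieckGroup.of b := by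
  obtain ⟨⟨a, b⟩, h⟩ := (Localization.monoidOf (⊤ : Submonoid N)).surj x
  exact ⟨a, b, eq_div_iff_mul_eq'.mpr h⟩

/-- `(ℤ_{≥0}, +)` is saturated: if `n · (a - b) ≥ 0` in `ℤ` then `a - b ≥ 0`.
[cite: MochizukiFrdI2008, §0 p.11] -/
theorem isSaturated_M : IsSaturated M := by
  refine ⟨fun x n hn ⟨m₀, hx⟩ => ?_⟩
  obtain ⟨a, b, rfl⟩ := gp_exists_eq_div x
  rw [div_pow, ← map_pow, ← map_pow, eq_div_iff_mul_eq', ← map_mul, gp_of_eq_of_iff] at hx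
  obtain ⟨c, hc⟩ := hx
  have hc' : m₀ * b ^ n = a ^ n := mul_left_cancel hc
  have hadd : m₀.toAdd + n * b.toAdd = n * a.toAdd := by
    have := congrArg Multiplicative.toAdd hc'
    rwa [toAdd_mul, toAdd_pow, toAdd_pow, smul_eq_mul, smul_eq_mul] at this
  have hle : b.toAdd ≤ a.toAdd := by
    have h1 : n * b.toAdd ≤ n * a.toAdd := by rw [← hadd]; exact Nat.le_add_left _ _
    exact Nat.le_of_mul_le_mul_left h1 hn
  refine ⟨Multiplicative.ofAdd (a.toAdd - b.toAdd), ?_⟩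
  rw [eq_div_iff_mul_eq', ← map_mul]
  congr 1
  apply congrArg Multiplicative.ofAdd
  show (a.toAdd - b.toAdd) + b.toAdd = a.toAdd
  exact Nat.sub_add_cancel hle

/-- `(ℤ_{≥0}, +)` is pre-divisorial (indeed divisorial). [cite: MochizukiFrdI2008, Def. 1.1(i) p.19] -/
theorem isPreDivisorial_M : IsPreDivisorial M :=
  { isIntegral := isIntegral_M, isSaturated := isSaturated_M, isOfCharType := isOfCharType_M }

/-! ### The one-morphism base category and the constant monoid `Φ_{ℤ_{≥0}}` -/

/-- The base category: the one-morphism category. [cite: MochizukiFrdI2008, Def. 1.1(iii) p.20] -/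
abbrev D : Type := Discrete PUnit.{1}

/-- The monoid `Φ_{ℤ_{≥0}}` on the one-morphism category: the constant functor with value
`(ℤ_{≥0}, +)` (written as a transparent structure so that its values compute; it is found's
`constMonoidOn (Multiplicative ℕ)`, see `Φst_eq_constMonoidOn`). [cite: MochizukiFrdI2008, Def. 1.1(iii) p.20] -/
abbrev Φst : Dᵒᵖ ⥤ CommMonCat.{0} where
  obj _ := CommMonCat.of M
  map _ := 𝟙 _

/-- `Φ_{ℤ_{≥0}}` is the constant monoid `Φ_M` of Def. 1.1 (iii) for `M = ℤ_{≥0}`.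
[cite: MochizukiFrdI2008, Def. 1.1(iii) p.20] -/
theorem Φst_eq_constMonoidOn : Φst = constMonoidOn M := rfl

/-- The pull-back maps of `Φ_{ℤ_{≥0}}` are identities. [cite: MochizukiFrdI2008, Def. 1.1(ii) p.19] -/
theorem pull_Φst {X Y : D} (g : X ⟶ Y) (x : Φst.obj (op Y)) : pull Φst g x = x := rfl

/-- Hom-types of the one-morphism category are subsingletons; every arrow is an isomorphism.
[cite: MochizukiFrdI2008, Def. 1.1(iii) p.20] -/
theorem isIso_D {X Y : D} (f : X ⟶ Y) : IsIso f :=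
  ⟨⟨eqToHom (by cases X; cases Y; rfl), Subsingleton.elim _ _, Subsingleton.elim _ _⟩⟩

/-- The one-morphism category is connected. [cite: MochizukiFrdI2008, Def. 1.1(iii) p.20] -/
theorem isGraphConnected_D : IsGraphConnected D :=
  ⟨⟨⟨PUnit.unit⟩⟩, fun X Y => by cases X; cases Y; exact Zigzag.refl _⟩

/-- The one-morphism category is totally epimorphic. [cite: MochizukiFrdI2008, Def. 1.1(iii) p.20] -/
theorem isTotallyEpimorphic_D : IsTotallyEpimorphic D :=
  ⟨fun f => by haveI := isIso_D f; infer_instance⟩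

/-- The one-morphism category is of FSM-type, hence of FSMFF-type (§0 p. 18).
[cite: MochizukiFrdI2008, §0 p.18] -/
theorem isOfFSMFFType_D : IsOfFSMFFType D :=
  (IsOfFSMType.mk fun f _ => isIso_D f).isOfFSMFFType

/-- `Φ_{ℤ_{≥0}}` is a monoid on the one-morphism category (its pull-back maps are identities).
[cite: MochizukiFrdI2008, Def. 1.1(ii) p.19] -/
theorem isMonoidOn_Φst : IsMonoidOn Φst where
  isCharInjective f := by
    refine ⟨fun x y h => h, fun x y hxy => ?_⟩
    obtain ⟨a, rfl⟩ := Associates.mk_surjective x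
    obtain ⟨b, rfl⟩ := Associates.mk_surjective y
    rw [associatesMap_mk, associatesMap_mk] at hxy
    exact hxy
  bijective_of_isFSM f _ := ⟨fun x y h => h, fun y => ⟨y, rfl⟩⟩

/-- `Φ_{ℤ_{≥0}}` is objectwise pre-divisorial. [cite: MochizukiFrdI2008, Def. 1.1(ii) p.19] -/
theorem objectwise_isPreDivisorial_Φst : Objectwise (fun N _ => IsPreDivisorial N) Φst :=
  fun _ => isPreDivisorial_M

/-- The standard Frobenioid `F_{Φ_{ℤ_{≥0}}} → F_{Φ^{char}}` is a Frobenioid (Prop. 1.5 (i)).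
[cite: MochizukiFrdI2008, Prop. 1.5(i) p.27] -/
theorem isFrobenioid : PreFrobenioid.IsFrobenioid (ElemFrobenioid.toChar Φst) :=
  ElemFrobenioid.isFrobenioid_toChar isMonoidOn_Φst objectwise_isPreDivisorial_Φst
    isGraphConnected_D isTotallyEpimorphic_D

/-- The standard Frobenioid is of isotropic type (Prop. 1.5 (i)). [cite: MochizukiFrdI2008, Prop. 1.5(i) p.27] -/
theorem isOfIsotropicType : PreFrobenioid.IsOfIsotropicType (ElemFrobenioid.toChar Φst) :=
  fun A => ElemFrobenioid.isIsotropic A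

/-! ### Morphisms of the standard Frobenioid: the zero divisor as a natural number -/

/-- The unique object. [cite: MochizukiFrdI2008, Def. 1.1(iii) p.20] -/
abbrev A : ElemFrobenioid Φst := ElemFrobenioid.of Φst ⟨PUnit.unit⟩

/-- The zero divisor `Div(φ) ∈ ℤ_{≥0}` of a morphism of the standard Frobenioid, as a natural number.
[cite: MochizukiFrdI2008, Def. 1.1(iii) p.20] -/
def dv {X Y : ElemFrobenioid Φst} (φ : X ⟶ Y) : ℕ := Multiplicative.toAdd (ElemFrobenioid.Div φ)

/-- Remark 1.1.1 in the standard Frobenioid: `Div(ψ ∘ φ) = Div(ψ) + deg_Fr(ψ) · Div(φ)`.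
[cite: MochizukiFrdI2008, Rem. 1.1.1] -/
theorem dv_comp {X Y Z : ElemFrobenioid Φst} (φ : X ⟶ Y) (ψ : Y ⟶ Z) :
    dv (φ ≫ ψ) = dv ψ + (ElemFrobenioid.degFr ψ : ℕ) * dv φ := rfl

/-- The zero divisor of `(f, n, k)` is `n`. [cite: MochizukiFrdI2008, Def. 1.1(iii) p.20] -/
theorem dv_homMk {X Y : ElemFrobenioid Φst} (f : X.base ⟶ Y.base) (n : ℕ) (k : ℕ+) :
    dv (ElemFrobenioid.homMk f (Multiplicative.ofAdd n) k) = n := rfl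

/-- `Div(φ) = 0` iff `dv φ = 0`. [cite: MochizukiFrdI2008, Def. 1.1(iii) p.20] -/
theorem div_eq_one_iff {X Y : ElemFrobenioid Φst} (φ : X ⟶ Y) : ElemFrobenioid.Div φ = 1 ↔ dv φ = 0 :=
  ⟨congrArg Multiplicative.toAdd, congrArg Multiplicative.ofAdd⟩

/-- A morphism `(f, 0, 1)` is an isomorphism. [cite: MochizukiFrdI2008, Prop. 1.5(i) p.27] -/
theorem isIso_of_dv_eq_zero {X Y : ElemFrobenioid Φst} (φ : X ⟶ Y) (hd : dv φ = 0)
    (hn : ElemFrobenioid.degFr φ = 1) : IsIso φ := by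
  haveI := isIso_D (ElemFrobenioid.Base φ)
  exact ElemFrobenioid.isIso_of_base_div_degFr φ (((div_eq_one_iff φ).mpr hd).symm ▸ isUnit_one) hn

/-- An isomorphism has zero divisor `0`. [cite: MochizukiFrdI2008, Rem. 1.1.1] -/
theorem dv_eq_zero_of_isIso {X Y : ElemFrobenioid Φst} (φ : X ⟶ Y) [IsIso φ] : dv φ = 0 :=
  (div_eq_one_iff φ).mp (eq_one_of_isUnit_M _ (ElemFrobenioid.isUnit_div_of_isIso φ))

/-- The morphism `(id, 1, 1)` of an object: an irreducible pre-step.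
[cite: MochizukiFrdI2008, Prop. 1.14(iii) p.41] -/
def stepOne (X : ElemFrobenioid Φst) : X ⟶ X :=
  ElemFrobenioid.homMk (𝟙 _) (Multiplicative.ofAdd (1 : ℕ)) 1

/-- `Div(id, 1, 1) = 1`. [cite: MochizukiFrdI2008, Def. 1.1(iii) p.20] -/
theorem dv_stepOne (X : ElemFrobenioid Φst) : dv (stepOne X) = 1 := rfl

/-- `deg_Fr(id, 1, 1) = 1`. [cite: MochizukiFrdI2008, Def. 1.1(iii) p.20] -/
theorem degFr_stepOne (X : ElemFrobenioid Φst) : ElemFrobenioid.degFr (stepOne X) = 1 := rfl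

/-- `(id, 1, 1)` is a pre-step. [cite: MochizukiFrdI2008, Def. 1.2(iii) p.23] -/
theorem isPreStep_stepOne (X : ElemFrobenioid Φst) :
    PreFrobenioid.IsPreStep (ElemFrobenioid.toChar Φst) (stepOne X) :=
  ⟨rfl, isIso_D _⟩

/-- A linear morphism with zero divisor `1` is irreducible: in `φ = α ∘ β` the zero divisors add
up to `1`, so one of `α`, `β` is `(iso, 0, 1)`. [cite: MochizukiFrdI2008, Prop. 1.14(i) p.41] -/
theorem isIrreducibleHom_of_dv_eq_one {X Y : ElemFrobenioid Φst} (φ : X ⟶ Y) (hd : dv φ = 1)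
    (hn : ElemFrobenioid.degFr φ = 1) : IsIrreducibleHom φ := by
  refine ⟨fun h => ?_, fun Z β α hfac => ?_⟩
  · have := dv_eq_zero_of_isIso φ
    omega
  have hdeg : ElemFrobenioid.degFr β * ElemFrobenioid.degFr α = 1 := by
    rw [← ElemFrobenioid.degFr_comp, hfac, hn]
  have hα1 : ElemFrobenioid.degFr α = 1 := PNat.eq (Nat.eq_one_of_mul_eq_one_left
    (by rw [← PNat.mul_coe, hdeg]; rfl))
  have hβ1 : ElemFrobenioid.degFr β = 1 := PNat.eq (Nat.eq_one_of_mul_eq_one_right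
    (by rw [← PNat.mul_coe, hdeg]; rfl))
  have hsum : dv α + dv β = 1 := by
    have h1 := congrArg dv hfac
    rw [dv_comp, hα1, PNat.one_coe, one_mul, hd] at h1
    exact h1
  rcases Nat.eq_zero_or_pos (dv α) with h0 | hpos
  · exact Or.inl (isIso_of_dv_eq_zero α h0 hα1)
  · exact Or.inr (isIso_of_dv_eq_zero β (by omega) hβ1)

/-- `(id, 1, 1)` is irreducible. [cite: MochizukiFrdI2008, Prop. 1.14(i) p.41] -/
theorem isIrreducibleHom_stepOne (X : ElemFrobenioid Φst) : IsIrreducibleHom (stepOne X) :=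
  isIrreducibleHom_of_dv_eq_one _ (dv_stepOne X) (degFr_stepOne X)

/-- A morphism of Frobenius degree `k ≥ 2` of the standard Frobenioid is NOT fiberwise-surjective:
against `γ = (id, Div + 1, k)` one would need `k · x = 1 + k · y` in `ℤ_{≥0}`. In particular
prime-Frobenius morphisms are not FSMI-morphisms. [cite: MochizukiFrdI2008, §0 p.14] -/
theorem degFr_eq_one_of_isFiberwiseSurjective {X Y : ElemFrobenioid Φst} (ψ : X ⟶ Y)
    (h : IsFiberwiseSurjective ψ) : ElemFrobenioid.degFr ψ = 1 := by
  obtain ⟨W, δ₁, δ₂, hδ⟩ := h (ElemFrobenioid.homMk (𝟙 _) (Multiplicative.ofAdd (dv ψ + 1))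
    (ElemFrobenioid.degFr ψ) : Y ⟶ Y)
  have h1 := congrArg dv hδ
  rw [dv_comp, dv_comp, dv_homMk, ElemFrobenioid.degFr_homMk] at h1
  -- `h1 : dv ψ + k * dv δ₁ = (dv ψ + 1) + k * dv δ₂`
  have h2 : (ElemFrobenioid.degFr ψ : ℕ) * dv δ₁ = (ElemFrobenioid.degFr ψ : ℕ) * dv δ₂ + 1 := by
    omega
  have hk : (ElemFrobenioid.degFr ψ : ℕ) ∣ 1 :=
    (Nat.dvd_add_right (dvd_mul_right _ _)).mp (h2 ▸ dvd_mul_right _ _)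
  exact PNat.eq (by rw [PNat.one_coe]; exact Nat.eq_one_of_dvd_one hk)

/-- Every FSMI-morphism of the standard Frobenioid is `(iso, 1, 1)`: Frobenius degree `1` and zero
divisor `1`. [cite: MochizukiFrdI2008, Prop. 1.14(iii) p.41] -/
theorem degFr_dv_of_isFSMI {X Y : ElemFrobenioid Φst} (ψ : X ⟶ Y) (h : IsFSMI ψ) :
    ElemFrobenioid.degFr ψ = 1 ∧ dv ψ = 1 := by
  have hdeg := degFr_eq_one_of_isFiberwiseSurjective ψ h.1.1
  refine ⟨hdeg, ?_⟩
  rcases Nat.lt_trichotomy (dv ψ) 1 with hlt | heq | hgt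
  · exact (h.2.1 (isIso_of_dv_eq_zero ψ (by omega) hdeg)).elim
  · exact heq
  · exfalso
    -- `ψ = (Base ψ, z - 1, 1) ∘ (id, 1, 1)` with neither factor an isomorphism
    have hfac : stepOne X ≫ ElemFrobenioid.homMk (ElemFrobenioid.Base ψ)
        (Multiplicative.ofAdd (dv ψ - 1)) 1 = ψ := by
      refine ElemFrobenioid.Hom.ext (Category.id_comp _) (Multiplicative.toAdd.injective ?_) hdeg.symm
      show dv (stepOne X ≫ ElemFrobenioid.homMk (ElemFrobenioid.Base ψ)
        (Multiplicative.ofAdd (dv ψ - 1)) 1) = dv ψ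
      rw [dv_comp, dv_homMk, dv_stepOne, ElemFrobenioid.degFr_homMk, PNat.one_coe]
      omega
    rcases h.2.2 (stepOne X) _ hfac with hαi | hβi
    · haveI := hαi
      have h2 := dv_eq_zero_of_isIso (ElemFrobenioid.homMk (ElemFrobenioid.Base ψ)
        (Multiplicative.ofAdd (dv ψ - 1)) 1)
      rw [dv_homMk] at h2
      omega
    · haveI := hβi
      have h2 := dv_eq_zero_of_isIso (stepOne X)
      rw [dv_stepOne] at h2
      omega

/-- A composite of `n` FSMI-morphisms of the standard Frobenioid has zero divisor `n` (and
Frobenius degree `1`). [cite: MochizukiFrdI2008, Prop. 1.14(iii) p.41] -/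
theorem dv_of_isFSMIChain {X Y : ElemFrobenioid Φst} {χ : X ⟶ Y} {n : ℕ} (h : IsFSMIChain χ n) :
    dv χ = n ∧ ElemFrobenioid.degFr χ = 1 := by
  induction h with
  | single α hα =>
    obtain ⟨hd, hz⟩ := degFr_dv_of_isFSMI α hα
    exact ⟨hz, hd⟩
  | cons α χ n hα _ ih =>
    obtain ⟨hd, hz⟩ := degFr_dv_of_isFSMI α hα
    refine ⟨?_, by rw [ElemFrobenioid.degFr_comp, hd, ih.2, mul_one]⟩
    rw [dv_comp, ih.1, ih.2, hz, PNat.one_coe, one_mul]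

/-! ### The refutation -/

/-- For the irreducible pre-step `φ = (id, 1, 1)` of the standard Frobenioid, the condition of
Prop. 1.14 (iii) HOLDS with `N = 2`: for every FSMI-morphism `ψ`, every expression of `ψ ∘ φ` as
a composite of `n` FSMI-morphisms has `n = 2`. [cite: MochizukiFrdI2008, Prop. 1.14(iii) p.41] -/
theorem chain_length_eq_two {X Y : ElemFrobenioid Φst} (ψ : X ⟶ Y) (hψ : IsFSMI ψ) {n : ℕ}
    (h : IsFSMIChain (stepOne X ≫ ψ) n) : n = 2 := by
  have h1 := (dv_of_isFSMIChain h).1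
  obtain ⟨hd, hz⟩ := degFr_dv_of_isFSMI ψ hψ
  rw [dv_comp, hz, hd, PNat.one_coe, dv_stepOne] at h1
  omega

/-- **Erratum for Prop. 1.14 (iii) as printed**: the statement `NonPreStepIffBoundedFSMIChains`
fails — in the standard Frobenioid (a Frobenioid of isotropic type over a base category of
FSMFF-type) the irreducible morphism `φ = (id, 1, 1)` IS a pre-step, yet the chain-length bound holds
(with `N = 2`). [cite: MochizukiFrdI2008, Prop. 1.14(iii) p.41] -/
theorem not_NonPreStepIffBoundedFSMIChains :
    ¬ PreFrobenioid.NonPreStepIffBoundedFSMIChains.{0, 0, 0, 0, 0} := by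
  intro h
  have h1 := h (ElemFrobenioid.toChar Φst) isFrobenioid isOfIsotropicType isOfFSMFFType_D (stepOne A)
    (isIrreducibleHom_stepOne A)
  exact (h1.mpr ⟨2, fun Y ψ n hψ hch => (chain_length_eq_two ψ hψ hch).le⟩) (isPreStep_stepOne A)

end StandardFrobenioidExample

end Literature.AlgebraicGeometry.Frobenioids
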